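import Literature.Computability.Cryptography.EntropyFlatteningConditional
import HarnessLib

/-!
# Inaccessible entropy ⇒ UOWHF: gap amplification by direct product (Haitner–Holenstein–Reingold–Vadhan–Wee 2020, Lemma 5.3), combinatorial core

Topic `Literature/Computability/Cryptography`; second file of the "one-way functions ⇒ universal one-way
hash functions" line (Rompel 1990 = Goldreich 2004, Thm. 6.4.29, via HHRVW, *Inaccessible Entropy II*,
Theory of Computing 16(8), 2020, Thm. 4.5 + Thm. 5.1; see `InaccessibleEntropyPrefixHash.lean` for the
plan). This file is the single-input-length, finite-counting content of **Lemma 5.3 (gap amplification)**: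
for the `t`-fold direct product `Fᵗ` (`prodMap`) of any `F : α → β` on a finite domain,

* **(i) real side** `card_realEntropy_prodMap_le_le_exp`: with `realEntropy F = E_a[log₂ |F⁻¹(F a)|]`
  (Def. 3.1, the real Shannon entropy of `F⁻¹`; `realEntropy_eq_sub` is the chain rule identifying it with
  the tree's `mapEntropy` difference), for `t ≥ 1`, `η ≥ 0`, `|α| ≥ 2` the inputs `w ∈ αᵗ` with
  `log₂ |(Fᵗ)⁻¹(Fᵗ w)| ≤ t · realEntropy F − tη log₂|α|` number at most `exp(−2tη²) |α|ᵗ` — a corollary of the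
  conditional flattening lemma `card_condSampleEntropy_tuple_le_le_exp` (`EntropyFlatteningConditional.lean`,
  Hoeffding; HHRVW's Lemma 2.3 with explicit constants, the sample entropies being bounded);
* **(ii) accessible side, concentration** `card_accEntropy_piFamily_ge_le_exp`: for a family of nonempty sets
  `L(a) ∋ a` with average `accEntropy L = E_a[log₂|L(a)|]`, the product family `piFamily L t w = ∏ᵢ L(wᵢ)`
  (`mem_piFamily`, `self_mem_piFamily`, `logb_card_piFamily`) has `log₂|L'(w)| ≥ t · accEntropy L + tη log₂|α|`
  for at most `exp(−2tη²) |α|ᵗ` tuples (Eq. (5.1), Chernoff–Hoeffding via `SamplingChernoff.lean`);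
* **(ii) accessible side, reduction** `card_mul_card_escape_piFamily_le`: for every product finder `A'` the
  planted single-coordinate finder `coordAdv A'` (plant the input at a uniform coordinate of a uniform tuple,
  answer with that coordinate of `A'`'s output; `plantEquiv` is the re-indexing bijection) satisfies
  `|α| · #{(w,r) : A'(w;r) ∉ L'(w)} ≤ #{(a,(j,w,r)) : coordAdv A' a (j,w,r) ∉ L(a)}`, i.e.
  `Pr[A' ∉ L'] ≤ t · Pr[A ∉ L]` after normalisation.

All statements are proved; no named facts, no machines, no asymptotics (those are assembled in the
machine-level files). Constants are explicit so that the final security bound can be computed.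

## References

* I. Haitner, T. Holenstein, O. Reingold, S. Vadhan, H. Wee, *Inaccessible Entropy II: IE Functions and
  Universal One-Way Hashing*, Theory of Computing 16(8) (2020) 1–55: Def. 3.1, Def. 3.9, Lemma 2.3,
  Lemma 5.3 and its proof (pp. 26–27).
* I. Haitner, O. Reingold, S. Vadhan, *Efficiency improvements in constructing pseudorandom generators from
  one-way functions*, SIAM J. Comput. 42(3) (2013), Lemma 2.1 (flattening; through
  `EntropyFlatteningConditional.lean`).
* W. Hoeffding, *Probability inequalities for sums of bounded random variables*, JASA 58 (1963), Thm. 2.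
-/

namespace Literature.Computability.Cryptography

namespace HHRVW

open Finset Real

variable {α β : Type*}

/-! ### Real entropy of `F⁻¹` and the direct product -/

section RealSide

variable [Fintype α] [DecidableEq α] [DecidableEq β]

/-- The **real Shannon entropy of `F⁻¹`**: `H(X | F(X)) = E_{a ← α}[log₂ |F⁻¹(F a)|]` for uniform `X`.
[cite: HaitnerEtAl2020, Def. 3.1] -/
noncomputable def realEntropy (F : α → β) : ℝ :=
  (∑ a, Real.logb 2 ((fiber univ F (F a)).card : ℝ)) / Fintype.card α

/-- The `t`-fold direct product `Fᵗ(x₁,…,x_t) = (F x₁, …, F x_t)`. [cite: HaitnerEtAl2020, Lemma 5.3] -/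
def prodMap (F : α → β) (t : ℕ) : (Fin t → α) → (Fin t → β) := fun w i => F (w i)

/-- Fibres of `id × F` are singletons. [folklore] -/
theorem card_fiber_graph (F : α → β) (a : α) :
    (fiber univ (fun v => (v, F v)) (a, F a)).card = 1 := by
  rw [Finset.card_eq_one]
  refine ⟨a, ?_⟩
  ext v
  simp only [mem_fiber, Finset.mem_univ, true_and, Prod.mk.injEq, Finset.mem_singleton]
  exact ⟨fun h => h.1, fun h => ⟨h, by rw [h]⟩⟩

/-- The entropy of the graph map `v ↦ (v, F v)` is `log₂ |α|`. [folklore] -/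
theorem mapEntropy_graph [Nonempty α] (F : α → β) :
    mapEntropy univ (fun v => (v, F v)) = Real.logb 2 (Fintype.card α) := by
  unfold mapEntropy
  have h : ∀ v : α, Real.logb 2 (((univ : Finset α).card : ℝ) / (fiber univ (fun v => (v, F v)) (v, F v)).card) =
      Real.logb 2 (Fintype.card α) := fun v => by
    rw [card_fiber_graph, Nat.cast_one, div_one, Finset.card_univ]
  rw [Finset.sum_congr rfl fun v _ => h v, Finset.sum_const, Finset.card_univ, nsmul_eq_mul]
  have hα : (Fintype.card α : ℝ) ≠ 0 := by exact_mod_cast Fintype.card_ne_zero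
  field_simp

/-- **Chain rule for `F⁻¹`**: `H(X | F(X)) = H(X, F(X)) − H(F(X))`, i.e.
`realEntropy F = mapEntropy univ (id × F) − mapEntropy univ F`. [cite: HaitnerEtAl2020, §2.3 (conditional entropies)] -/
theorem realEntropy_eq_sub [Nonempty α] (F : α → β) :
    realEntropy F = mapEntropy univ (fun v => (v, F v)) - mapEntropy univ F := by
  rw [mapEntropy_graph]
  unfold realEntropy mapEntropy
  have hα : (0 : ℝ) < Fintype.card α := by exact_mod_cast Fintype.card_pos
  rw [Finset.card_univ, eq_sub_iff_add_eq, ← add_div, ← Finset.sum_add_distrib]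
  have h : ∀ v : α, Real.logb 2 ((fiber univ F (F v)).card : ℝ) +
      Real.logb 2 ((Fintype.card α : ℝ) / (fiber univ F (F v)).card) = Real.logb 2 (Fintype.card α) := by
    intro v
    have hf : (0 : ℝ) < (fiber univ F (F v)).card := by exact_mod_cast card_fiber_univ_pos F v
    rw [Real.logb_div hα.ne' hf.ne']; ring
  rw [Finset.sum_congr rfl fun v _ => h v, Finset.sum_const, Finset.card_univ, nsmul_eq_mul]
  field_simp

omit [DecidableEq α] in
/-- The real sample entropy of the product is the sum over the coordinates:
`log₂ |(Fᵗ)⁻¹(Fᵗ w)| = Σᵢ log₂ |F⁻¹(F wᵢ)|`. [cite: HaitnerEtAl2020, Lemma 5.3 (i) (proof, via Lemma 2.3)] -/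
theorem logb_card_fiber_prodMap (F : α → β) {t : ℕ} (w : Fin t → α) :
    Real.logb 2 ((fiber univ (prodMap F t) (prodMap F t w)).card : ℝ) =
      ∑ i, Real.logb 2 ((fiber univ F (F (w i))).card : ℝ) := by
  have h : (fiber univ (prodMap F t) (prodMap F t w)).card = ∏ i, (fiber univ F (F (w i))).card :=
    card_fiber_tuple F w
  rw [h, Nat.cast_prod]
  exact Real.logb_prod _ _ fun i _ => by exact_mod_cast (card_fiber_univ_pos F (w i)).ne'

/-- **Lemma 5.3 (i)** (HHRVW 2020; flattening, Lemma 2.3): for `t ≥ 1`, `η ≥ 0`, `|α| ≥ 2`, the inputs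
`w ∈ αᵗ` of the `t`-fold product whose real sample entropy `log₂ |(Fᵗ)⁻¹(Fᵗ w)|` is at most
`t · H(X|F(X)) − tη · log₂|α|` number at most `exp(−2tη²) · |α|ᵗ` — the real Shannon entropy of `F⁻¹`
becomes real min-entropy of `(Fᵗ)⁻¹`. [cite: HaitnerEtAl2020, Lemma 5.3 (i)] -/
theorem card_realEntropy_prodMap_le_le_exp [Nonempty α] (F : α → β) {t : ℕ} (ht : 0 < t) {η : ℝ}
    (hη : 0 ≤ η) (hα : 1 < Fintype.card α) :
    ((univ.filter fun w : Fin t → α =>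
        Real.logb 2 ((fiber univ (prodMap F t) (prodMap F t w)).card : ℝ) ≤
          t * realEntropy F - t * η * Real.logb 2 (Fintype.card α)).card : ℝ) ≤
      Real.exp (-2 * t * η ^ 2) * (Fintype.card α : ℝ) ^ t := by
  have h := card_condSampleEntropy_tuple_le_le_exp (x := (id : α → α)) (y := F) ht hη hα
  simp only [id] at h
  rw [← realEntropy_eq_sub] at h
  refine le_trans (le_of_eq ?_) h
  congr 2
  ext w
  simp only [Finset.mem_filter, Finset.mem_univ, true_and]
  rw [logb_card_fiber_prodMap]
  have hterm : ∀ i : Fin t, Real.logb 2 (((fiber univ F (F (w i))).card : ℝ) /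
      (fiber univ (fun v => (v, F v)) (w i, F (w i))).card) = Real.logb 2 ((fiber univ F (F (w i))).card : ℝ) := by
    intro i
    rw [card_fiber_graph, Nat.cast_one, div_one]
  rw [Finset.sum_congr rfl fun i _ => hterm i]

end RealSide

/-! ### Accessible side: product set families -/

section AccSide

/-- The product set family `L'(x₁,…,x_t) = L(x₁) × ⋯ × L(x_t)`. [cite: HaitnerEtAl2020, Lemma 5.3 (ii) (proof)] -/
def piFamily (L : α → Finset α) (t : ℕ) (w : Fin t → α) : Finset (Fin t → α) :=
  Fintype.piFinset fun i => L (w i)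

/-- Membership in the product family is coordinatewise. [cite: HaitnerEtAl2020, Lemma 5.3 (ii) (proof)] -/
@[simp] theorem mem_piFamily {L : α → Finset α} {t : ℕ} {w v : Fin t → α} :
    v ∈ piFamily L t w ↔ ∀ i, v i ∈ L (w i) := by
  simp [piFamily]

/-- `w ∈ L'(w)` when `a ∈ L(a)` for all `a`. [cite: HaitnerEtAl2020, Lemma 5.3 (ii) (proof)] -/
theorem self_mem_piFamily {L : α → Finset α} (hL : ∀ a, a ∈ L a) {t : ℕ} (w : Fin t → α) :
    w ∈ piFamily L t w :=
  mem_piFamily.2 fun i => hL (w i)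

/-- `|L'(w)| = ∏ᵢ |L(wᵢ)|`. [cite: HaitnerEtAl2020, Lemma 5.3 (ii) (proof)] -/
theorem card_piFamily (L : α → Finset α) {t : ℕ} (w : Fin t → α) :
    (piFamily L t w).card = ∏ i, (L (w i)).card := by
  rw [piFamily, Fintype.card_piFinset]

/-- `log₂ |L'(w)| = Σᵢ log₂ |L(wᵢ)|` (for nonempty `L(a)`).
[cite: HaitnerEtAl2020, Lemma 5.3 (ii) (proof, "by linearity of expectations")] -/
theorem logb_card_piFamily {L : α → Finset α} (hL : ∀ a, 0 < (L a).card) {t : ℕ} (w : Fin t → α) :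
    Real.logb 2 ((piFamily L t w).card : ℝ) = ∑ i, Real.logb 2 ((L (w i)).card : ℝ) := by
  rw [card_piFamily, Nat.cast_prod]
  exact Real.logb_prod _ _ fun i _ => by exact_mod_cast (hL (w i)).ne'

variable [Fintype α]

/-- The **average accessible entropy** of a set family: `E_a[log₂ |L(a)|]`.
[cite: HaitnerEtAl2020, Def. 3.9 (accessible average max-entropy)] -/
noncomputable def accEntropy (L : α → Finset α) : ℝ :=
  (∑ a, Real.logb 2 ((L a).card : ℝ)) / Fintype.card α

/-- **Lemma 5.3 (ii), concentration part** (HHRVW 2020, Eq. (5.1)): for `t ≥ 1`, `η ≥ 0`, `|α| ≥ 2` and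
a family of nonempty sets, the inputs `w ∈ αᵗ` with `log₂ |L'(w)| ≥ t · E[log₂|L|] + tη · log₂|α|` number
at most `exp(−2tη²) · |α|ᵗ` (Chernoff–Hoeffding, `log₂|L(a)| ∈ [0, log₂|α|]`).
[cite: HaitnerEtAl2020, Lemma 5.3 (ii), Eq. (5.1)] -/
theorem card_accEntropy_piFamily_ge_le_exp [Nonempty α] {L : α → Finset α} (hL : ∀ a, 0 < (L a).card)
    {t : ℕ} (ht : 0 < t) {η : ℝ} (hη : 0 ≤ η) (hα : 1 < Fintype.card α) :
    ((univ.filter fun w : Fin t → α =>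
        t * accEntropy L + t * η * Real.logb 2 (Fintype.card α) ≤
          Real.logb 2 ((piFamily L t w).card : ℝ)).card : ℝ) ≤
      Real.exp (-2 * t * η ^ 2) * (Fintype.card α : ℝ) ^ t := by
  classical
  set Lg : ℝ := Real.logb 2 (Fintype.card α) with hLg
  have hαR : (1 : ℝ) < Fintype.card α := by exact_mod_cast hα
  have hLg0 : 0 < Lg := Real.logb_pos (by norm_num) hαR
  set G : α → ℝ := fun a => Real.logb 2 ((L a).card : ℝ) / Lg with hG
  have hG01 : ∀ a, G a ∈ Set.Icc (0 : ℝ) 1 := fun a => by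
    have h1 : (1 : ℝ) ≤ (L a).card := by exact_mod_cast hL a
    have h2 : ((L a).card : ℝ) ≤ Fintype.card α := by exact_mod_cast Finset.card_le_univ (L a)
    refine ⟨div_nonneg (Real.logb_nonneg (by norm_num) h1) hLg0.le, ?_⟩
    rw [div_le_one hLg0, hLg]
    exact Real.logb_le_logb_of_le (by norm_num) (by linarith) h2
  have h := Complexity.card_upperDeviation_sum_le_exp G hG01 ht hη
  rw [Fintype.card_pi_const, Nat.cast_pow] at h
  refine le_trans ?_ h
  refine Nat.cast_le.2 (Finset.card_le_card fun w hw => ?_)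
  rw [Finset.mem_filter] at hw ⊢
  refine ⟨Finset.mem_univ _, ?_⟩
  have havg : (∑ a, G a) / Fintype.card α = accEntropy L / Lg := by
    simp only [hG, accEntropy]
    rw [← Finset.sum_div, div_right_comm]
  have hsum : ∑ i, G (w i) = (∑ i, Real.logb 2 ((L (w i)).card : ℝ)) / Lg := by
    simp only [hG]; rw [Finset.sum_div]
  rw [havg, hsum, ← logb_card_piFamily hL]
  have hw2 : (t : ℝ) * accEntropy L + t * η * Lg ≤ Real.logb 2 ((piFamily L t w).card : ℝ) := hw.2
  rw [show Real.logb 2 ((piFamily L t w).card : ℝ) / Lg - t * (accEntropy L / Lg) =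
      (Real.logb 2 ((piFamily L t w).card : ℝ) - t * accEntropy L) / Lg by field_simp]
  rw [le_div_iff₀ hLg0]
  linarith

/-! ### The coordinate-planting reduction -/

variable {Ω : Type*}

/-- **The single-coordinate collision finder of Lemma 5.3 (ii)**: `A(a; j, w, r)` plants `a` at a uniform
coordinate `j` of a uniform tuple `w`, runs the `Fᵗ`-collision finder `A'` and outputs the `j`-th
coordinate of its answer. [cite: HaitnerEtAl2020, Lemma 5.3 (ii) (proof, the algorithm `A`)] -/
def coordAdv {t : ℕ} (A' : (Fin t → α) → Ω → (Fin t → α)) (a : α) (c : Fin t × (Fin t → α) × Ω) : α :=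
  A' (Function.update c.2.1 c.1 a) c.2.2 c.1

/-- Planting is a bijection: `(a, w) ↦ (w[j ↦ a], w j)`. [folklore] -/
def plantEquiv {t : ℕ} (j : Fin t) : α × (Fin t → α) ≃ (Fin t → α) × α where
  toFun p := (Function.update p.2 j p.1, p.2 j)
  invFun q := (q.1 j, Function.update q.1 j q.2)
  left_inv p := by
    rcases p with ⟨a, w⟩
    simp only [Function.update_self, Function.update_idem, Function.update_eq_self]
  right_inv q := by
    rcases q with ⟨w, b⟩
    simp only [Function.update_self, Function.update_idem, Function.update_eq_self]

variable [DecidableEq α]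

/-- **Lemma 5.3 (ii), reduction part**: if the product finder `A'` escapes the product family with
`N'` of its `(w, r)`, then the planted single-coordinate finder escapes the original family with at least
`|α| · N'` of its `(a, (j, w, r))` — i.e. `Pr[A'(W) ∉ L'(W)] ≤ t · Pr[A(X) ∉ L(X)]` after normalising
(`|α| · t · |α|ᵗ · |Ω|` versus `|α|ᵗ · |Ω|` sample points). [cite: HaitnerEtAl2020, Lemma 5.3 (ii)] -/
theorem card_mul_card_escape_piFamily_le [Fintype Ω] (L : α → Finset α) {t : ℕ}
    (A' : (Fin t → α) → Ω → (Fin t → α)) :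
    Fintype.card α * ((univ : Finset ((Fin t → α) × Ω)).filter fun p => A' p.1 p.2 ∉ piFamily L t p.1).card ≤
      ((univ : Finset (α × (Fin t × (Fin t → α) × Ω))).filter fun q => coordAdv A' q.1 q.2 ∉ L q.1).card := by
  classical
  rw [Finset.card_filter, Finset.card_filter]
  simp only [Fintype.sum_prod_type]
  -- re-index each coordinate count by planting: `(a, w) ↦ (w[j ↦ a], w j)`
  have hj : ∀ j : Fin t, (∑ a, ∑ w : Fin t → α, ∑ r : Ω,
        (if coordAdv A' a (j, w, r) ∉ L a then 1 else 0 : ℕ)) =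
      Fintype.card α * ∑ w : Fin t → α, ∑ r : Ω, (if A' w r j ∉ L (w j) then 1 else 0 : ℕ) := by
    intro j
    show (∑ a, ∑ w : Fin t → α, ∑ r : Ω, (if A' (Function.update w j a) r j ∉ L a then 1 else 0 : ℕ)) = _
    have h1 : (∑ a, ∑ w : Fin t → α, ∑ r : Ω, (if A' (Function.update w j a) r j ∉ L a then 1 else 0 : ℕ)) =
        ∑ p : α × (Fin t → α), ∑ r : Ω, (if A' (Function.update p.2 j p.1) r j ∉ L p.1 then 1 else 0 : ℕ) := by
      rw [Fintype.sum_prod_type]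
    rw [h1, Fintype.sum_equiv (plantEquiv j) _ (fun q : (Fin t → α) × α =>
      ∑ r : Ω, (if A' q.1 r j ∉ L (q.1 j) then 1 else 0 : ℕ))]
    · rw [Fintype.sum_prod_type]
      show ∑ w : Fin t → α, ∑ _b : α, ∑ r : Ω, (if A' w r j ∉ L (w j) then 1 else 0 : ℕ) = _
      simp only [Finset.sum_const, Finset.card_univ, smul_eq_mul, Finset.mul_sum]
    · rintro ⟨a, w⟩
      simp [plantEquiv]
  -- the right-hand side, coordinate by coordinate
  conv_rhs => rw [Finset.sum_comm]
  simp_rw [hj]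
  rw [← Finset.mul_sum]
  refine Nat.mul_le_mul_left _ ?_
  -- union bound over the coordinates
  have hre : ∑ j : Fin t, ∑ w : Fin t → α, ∑ r : Ω, (if A' w r j ∉ L (w j) then 1 else 0 : ℕ) =
      ∑ w : Fin t → α, ∑ r : Ω, ∑ j : Fin t, (if A' w r j ∉ L (w j) then 1 else 0 : ℕ) := by
    rw [Finset.sum_comm]
    exact Finset.sum_congr rfl fun w _ => Finset.sum_comm
  rw [hre]
  refine Finset.sum_le_sum fun w _ => Finset.sum_le_sum fun r _ => ?_
  by_cases hp : A' w r ∈ piFamily L t w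
  · rw [if_neg (not_not_intro hp)]
    exact Nat.zero_le _
  · rw [if_pos hp]
    obtain ⟨j, hj'⟩ : ∃ j, A' w r j ∉ L (w j) := by
      by_contra hall
      push Not at hall
      exact hp (mem_piFamily.2 hall)
    calc 1 = (if A' w r j ∉ L (w j) then 1 else 0 : ℕ) := by rw [if_pos hj']
      _ ≤ ∑ j, (if A' w r j ∉ L (w j) then 1 else 0 : ℕ) :=
          Finset.single_le_sum (f := fun j => (if A' w r j ∉ L (w j) then 1 else 0 : ℕ))
            (fun j _ => Nat.zero_le _) (Finset.mem_univ j)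

end AccSide

end HHRVW

end Literature.Computability.Cryptography
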